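import Summits.Ventures.HodgeRepro2.T6MainM2
import Summits.Ventures.HodgeRepro2.T6MainM3Stmt
import Summits.Ventures.HodgeRepro2.T6N3HsSplice

/-!
# T6MainM3 — THE WAVE-1 RECOMPOSITION: the closed theorem inhabiting `HCCMOfPublished₃` (TARGET-T6 §11.0)

Cell pub-hodge-repro2, Tier 6 (README §10). The lead's file (t6-lead g18), generated with the statement (folder g18/gen_m3.py).
`hccmOfPublished₃_holds` is `hccmOfPublished₂_holds` (T6MainM2, p417463) applied, binder by binder of `HCCMOfPublished₂`, to the
₃ binder of the same content or to the owner's theorem that discharges it: `Hyp.Hartshorne1977_productProjective_holds` /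
`_pointProjective_holds` (rows 8–9), `SurfaceDatum.ofProjectivePlane C` (row 12), `A1EigenGen.eGen K` / `eGen_mem K` (rows 14–15),
`(M4 …).toNAut3` (row 16), `NAut4.explicitShape` / `admGenerating` (rows 18–22), `(T …).R` and t6-p3's
`RogawskiTrace.hs_of_identity` (T6N3HsSplice; rows 23, 27), `N3SideRich.toSide_kliftCont` / `_adjoint` / `_copiesOrthogonal` / `_tensorsSpan` (rows 46 48 52 63 / 68 70 74 85),
`hostFockRecEL n₁ n₂ n₃` with `rfl` (rows 86–88), `HostReadings.ofDisplays … |>.irreducibleSmooth / .firstLift` (rows 89 92 / 132 135),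
`NSide4.hEL₁/₂/₃` / `hA2f₂/₃` (rows 95–99 / 138–142), the bundle's fields `d41p.Pl In Sp LQ Kd` (rows 112–116 / 155–159) and
`PlaceFamily.solves_realCondB_of_eq_displays_Li` (rows 182–183). No `sorry`;
standard axioms (trio, guard-checked). §8(d): uses an L-value-free non-vanishing device: NO.
-/

noncomputable section

open CategoryTheory
open HostAPI.Carriers.AlgebraicGeometry.Motives HostAPI.Carriers.AlgebraicGeometry.HodgeTheory

namespace Summit.Ventures.HodgeRepro2.T6

open Summit.Ventures.HodgeRepro2.T6.Host Summit.Ventures.HodgeRepro2.T6.WeilInst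
  Summit.Ventures.HodgeRepro2.T6.WeilAssembly Summit.Ventures.HodgeRepro2.T6.A1HostBridge
  Summit.Ventures.HodgeRepro2.T6.HostCoeff
open N5Skeleton
open scoped InnerProductSpace

/-- **THE WAVE-1 RECOMPOSITION**: `HCCMOfPublished₃` holds — `HostAPI.HCCM.Statement` from the published displays and the M3 datum,
by `hccmOfPublished₂_holds` applied to the ₃ binders and the owners' wave-1 theorems. -/
theorem hccmOfPublished₃_holds : HCCMOfPublished₃ :=
  fun h0 hS4 hBd h17 hD hLefD hT21 Choice Adm τ₁ M4 hex T hR0 hR1 hR2 hI hE hLI hU hOne hst hRbr hO hsimp hPX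
    hPeqX hPY hPeqY hσX hσ hN1H hN1L hN1A hN1B ιA LA hHDA hHDbrA hSeamA hKLA hΘτA hEA hInclA hTauA hDecA hFA hCA
    hAvgA hEqA hSpanA hCOA hIndA ιB LB hHDB hHDbrB hSeamB hKLB hΘτB hEB hInclB hTauB hDecB hFB hCB hAvgB hEqB
    hSpanB hCOB hIndB S_shA _IsL2AutA _IsFinA hL2A hAutA hFinA h571A h57nA spA nsA readSplitA readNonsplitA hspA
    hnsA FA hLiftA readA hreadA hposA hnmA hMA hGIA hB₁A hB₂A hB₃A hGQTA hLRA hpadicA hI₁eA hI₂eA hI₁A hI₂A hP₁A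
    hP₂A hLR7A hBumpA hHaA hRoA hMinA hB451A hRaoA hdichA hκ'A hRA TdA hRIPA hU116A hZsA hZnA S_shB _IsL2AutB
    _IsFinB hL2B hAutB hFinB h571B h57nB spB nsB readSplitB readNonsplitB hspB hnsB FB hLiftB readB hreadB hposB
    hnmB hMB hGIB hB₁B hB₂B hB₃B hGQTB hLRB hpadicB hI₁eB hI₂eB hI₁B hI₂B hP₁B hP₂B hLR7B hBumpB hHaB hRoB hMinB
    hB451B hRaoB hdichB hκ'B hRB TdB hRIPB hU116B hZsB hZnB hT R5 hR5 hL dict hA hB F5 hF5 RP5 hS5 h35A5 h35B5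
    hLiA5 hLiB5 h51A5 h51B5 hc5 =>
  hccmOfPublished₂_holds h0 hS4 hBd h17 hD hLefD hT21 Hyp.Hartshorne1977_productProjective_holds
    Hyp.Hartshorne1977_pointProjective_holds Choice Adm (fun _Bd _hB _K _ _ _ _ C _c =>
    SurfaceDatum.ofProjectivePlane C) τ₁ (fun _Bd _hB K _ _ _ _ _C => A1EigenGen.eGen K) (fun _Bd _hB K _ _ _ _
    _C => A1EigenGen.eGen_mem K) (fun Bd hB K _ _ _ _ C => (M4 Bd hB K C).toNAut3) hex (fun Bd hB K _ _ _ _ C =>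
    (M4 Bd hB K C).explicitShape.1) (fun Bd hB K _ _ _ _ C => (M4 Bd hB K C).explicitShape.2.1) (fun Bd hB K _ _
    _ _ C => (M4 Bd hB K C).explicitShape.2.2.1) (fun Bd hB K _ _ _ _ C => (M4 Bd hB K C).explicitShape.2.2.2)
    (fun Bd hB K _ _ _ _ C => (M4 Bd hB K C).admGenerating) (fun Bd hB K _ _ _ _ C => (T Bd hB K C).R) hR0 hR1
    hR2 (fun Bd hB K _ _ _ _ C => (T Bd hB K C).hs_of_identity (hI Bd hB K C) (hE Bd hB K C) (hLI Bd hB K C) (hU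
    Bd hB K C) (hOne Bd hB K C)) hst hRbr hO hsimp hPX hPeqX hPY hPeqY hσX hσ hN1H hN1L hN1A hN1B ιA LA hHDA
    hHDbrA (fun Bd hB K _ _ _ _ C => (M4 Bd hB K C).d3r.A.toSide_kliftCont) hSeamA (fun Bd hB K _ _ _ _ C => (M4
    Bd hB K C).d3r.A.toSide_adjoint) hKLA hΘτA hEA (fun Bd hB K _ _ _ _ C => (M4 Bd hB K
    C).d3r.A.toSide_copiesOrthogonal) hInclA hTauA hDecA hFA hCA hAvgA hEqA hSpanA hCOA hIndA (fun Bd hB K _ _ _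
    _ C => (M4 Bd hB K C).d3r.A.toSide_tensorsSpan) ιB LB hHDB hHDbrB (fun Bd hB K _ _ _ _ C => (M4 Bd hB K
    C).d3r.B.toSide_kliftCont) hSeamB (fun Bd hB K _ _ _ _ C => (M4 Bd hB K C).d3r.B.toSide_adjoint) hKLB hΘτB
    hEB (fun Bd hB K _ _ _ _ C => (M4 Bd hB K C).d3r.B.toSide_copiesOrthogonal) hInclB hTauB hDecB hFB hCB hAvgB
    hEqB hSpanB hCOB hIndB (fun Bd hB K _ _ _ _ C => (M4 Bd hB K C).d3r.B.toSide_tensorsSpan) (fun Bd hB K _ _ _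
    _ C => N43Host.BergmanPlaces.hostFockRecEL (M4 Bd hB K C).sA.n₁ (M4 Bd hB K C).sA.n₂ (M4 Bd hB K C).sA.n₃)
    (fun Bd hB K _ _ _ _ C => N43Host.BergmanPlaces.hostFockRecEL (M4 Bd hB K C).sB.n₁ (M4 Bd hB K C).sB.n₂ (M4
    Bd hB K C).sB.n₃) (fun _ _ _ _ _ _ _ _ => rfl) (fun _ _ _ _ _ _ _ _ => rfl) (fun Bd hB K _ _ _ _ C =>
    (N42Flath.HostReadings.ofDisplays (FA Bd hB K C) (hLiftA Bd hB K C) (S_shA Bd hB K C) (h571A Bd hB K C)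
    (h57nA Bd hB K C) ((hL2A Bd hB K C) (hAutA Bd hB K C) (hFinA Bd hB K C)) (spA Bd hB K C) (nsA Bd hB K C)
    (readSplitA Bd hB K C) (readNonsplitA Bd hB K C) (readA Bd hB K C)).irreducibleSmooth
    (N42Flath.HostReadings.isReading_ofDisplays (FA Bd hB K C) (hLiftA Bd hB K C) (S_shA Bd hB K C) (h571A Bd hB
    K C) (h57nA Bd hB K C) ((hL2A Bd hB K C) (hAutA Bd hB K C) (hFinA Bd hB K C)) (spA Bd hB K C) (nsA Bd hB K
    C) (readSplitA Bd hB K C) (readNonsplitA Bd hB K C) (readA Bd hB K C) (hspA Bd hB K C) (hnsA Bd hB K C)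
    (hposA Bd hB K C) (hnmA Bd hB K C) (hreadA Bd hB K C))) hposA hnmA (fun Bd hB K _ _ _ _ C =>
    (N42Flath.HostReadings.ofDisplays (FA Bd hB K C) (hLiftA Bd hB K C) (S_shA Bd hB K C) (h571A Bd hB K C)
    (h57nA Bd hB K C) ((hL2A Bd hB K C) (hAutA Bd hB K C) (hFinA Bd hB K C)) (spA Bd hB K C) (nsA Bd hB K C)
    (readSplitA Bd hB K C) (readNonsplitA Bd hB K C) (readA Bd hB K C)).firstLift
    (N42Flath.HostReadings.isReading_ofDisplays (FA Bd hB K C) (hLiftA Bd hB K C) (S_shA Bd hB K C) (h571A Bd hB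
    K C) (h57nA Bd hB K C) ((hL2A Bd hB K C) (hAutA Bd hB K C) (hFinA Bd hB K C)) (spA Bd hB K C) (nsA Bd hB K
    C) (readSplitA Bd hB K C) (readNonsplitA Bd hB K C) (readA Bd hB K C) (hspA Bd hB K C) (hnsA Bd hB K C)
    (hposA Bd hB K C) (hnmA Bd hB K C) (hreadA Bd hB K C))) hMA hGIA (fun Bd hB K _ _ _ _ C => (M4 Bd hB K
    C).sA.hEL₁) (fun Bd hB K _ _ _ _ C => (M4 Bd hB K C).sA.hA2f₂) (fun Bd hB K _ _ _ _ C => (M4 Bd hB K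
    C).sA.hEL₂) (fun Bd hB K _ _ _ _ C => (M4 Bd hB K C).sA.hA2f₃) (fun Bd hB K _ _ _ _ C => (M4 Bd hB K
    C).sA.hEL₃) hB₁A hB₂A hB₃A hGQTA hLRA hpadicA hI₁eA hI₂eA hI₁A hI₂A hP₁A hP₂A (fun Bd hB K _ _ _ _ C => (M4
    Bd hB K C).sA.d41p.Pl) (fun Bd hB K _ _ _ _ C => (M4 Bd hB K C).sA.d41p.In) (fun Bd hB K _ _ _ _ C => (M4 Bd
    hB K C).sA.d41p.Sp) (fun Bd hB K _ _ _ _ C => (M4 Bd hB K C).sA.d41p.LQ) (fun Bd hB K _ _ _ _ C => (M4 Bd hB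
    K C).sA.d41p.Kd) hLR7A hBumpA hHaA hRoA hMinA hB451A hRaoA hdichA hκ'A hRA TdA hRIPA hU116A hZsA hZnA (fun
    Bd hB K _ _ _ _ C => (N42Flath.HostReadings.ofDisplays (FB Bd hB K C) (hLiftB Bd hB K C) (S_shB Bd hB K C)
    (h571B Bd hB K C) (h57nB Bd hB K C) ((hL2B Bd hB K C) (hAutB Bd hB K C) (hFinB Bd hB K C)) (spB Bd hB K C)
    (nsB Bd hB K C) (readSplitB Bd hB K C) (readNonsplitB Bd hB K C) (readB Bd hB K C)).irreducibleSmooth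
    (N42Flath.HostReadings.isReading_ofDisplays (FB Bd hB K C) (hLiftB Bd hB K C) (S_shB Bd hB K C) (h571B Bd hB
    K C) (h57nB Bd hB K C) ((hL2B Bd hB K C) (hAutB Bd hB K C) (hFinB Bd hB K C)) (spB Bd hB K C) (nsB Bd hB K
    C) (readSplitB Bd hB K C) (readNonsplitB Bd hB K C) (readB Bd hB K C) (hspB Bd hB K C) (hnsB Bd hB K C)
    (hposB Bd hB K C) (hnmB Bd hB K C) (hreadB Bd hB K C))) hposB hnmB (fun Bd hB K _ _ _ _ C =>
    (N42Flath.HostReadings.ofDisplays (FB Bd hB K C) (hLiftB Bd hB K C) (S_shB Bd hB K C) (h571B Bd hB K C)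
    (h57nB Bd hB K C) ((hL2B Bd hB K C) (hAutB Bd hB K C) (hFinB Bd hB K C)) (spB Bd hB K C) (nsB Bd hB K C)
    (readSplitB Bd hB K C) (readNonsplitB Bd hB K C) (readB Bd hB K C)).firstLift
    (N42Flath.HostReadings.isReading_ofDisplays (FB Bd hB K C) (hLiftB Bd hB K C) (S_shB Bd hB K C) (h571B Bd hB
    K C) (h57nB Bd hB K C) ((hL2B Bd hB K C) (hAutB Bd hB K C) (hFinB Bd hB K C)) (spB Bd hB K C) (nsB Bd hB K
    C) (readSplitB Bd hB K C) (readNonsplitB Bd hB K C) (readB Bd hB K C) (hspB Bd hB K C) (hnsB Bd hB K C)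
    (hposB Bd hB K C) (hnmB Bd hB K C) (hreadB Bd hB K C))) hMB hGIB (fun Bd hB K _ _ _ _ C => (M4 Bd hB K
    C).sB.hEL₁) (fun Bd hB K _ _ _ _ C => (M4 Bd hB K C).sB.hA2f₂) (fun Bd hB K _ _ _ _ C => (M4 Bd hB K
    C).sB.hEL₂) (fun Bd hB K _ _ _ _ C => (M4 Bd hB K C).sB.hA2f₃) (fun Bd hB K _ _ _ _ C => (M4 Bd hB K
    C).sB.hEL₃) hB₁B hB₂B hB₃B hGQTB hLRB hpadicB hI₁eB hI₂eB hI₁B hI₂B hP₁B hP₂B (fun Bd hB K _ _ _ _ C => (M4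
    Bd hB K C).sB.d41p.Pl) (fun Bd hB K _ _ _ _ C => (M4 Bd hB K C).sB.d41p.In) (fun Bd hB K _ _ _ _ C => (M4 Bd
    hB K C).sB.d41p.Sp) (fun Bd hB K _ _ _ _ C => (M4 Bd hB K C).sB.d41p.LQ) (fun Bd hB K _ _ _ _ C => (M4 Bd hB
    K C).sB.d41p.Kd) hLR7B hBumpB hHaB hRoB hMinB hB451B hRaoB hdichB hκ'B hRB TdB hRIPB hU116B hZsB hZnB hT R5
    hR5 hL dict hA hB (fun Bd hB K _ _ _ _ C => ((F5 Bd hB K C).solves_realCondB_of_eq_displays_Li (R5 Bd hB K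
    C) (hF5 Bd hB K C) (RP5 Bd hB K C) (hS5 Bd hB K C) (h35A5 Bd hB K C) (h35B5 Bd hB K C) (hLiA5 Bd hB K C)
    (hLiB5 Bd hB K C) (h51A5 Bd hB K C) (h51B5 Bd hB K C)).1) (fun Bd hB K _ _ _ _ C => ((F5 Bd hB K
    C).solves_realCondB_of_eq_displays_Li (R5 Bd hB K C) (hF5 Bd hB K C) (RP5 Bd hB K C) (hS5 Bd hB K C) (h35A5
    Bd hB K C) (h35B5 Bd hB K C) (hLiA5 Bd hB K C) (hLiB5 Bd hB K C) (h51A5 Bd hB K C) (h51B5 Bd hB K C)).2) hc5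

end Summit.Ventures.HodgeRepro2.T6

end
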